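import Summits.ValiantsHypothesis.ValiantsHypothesis.Theorems.LacunarySymmetroidMatrixDescartesDoorA26WallBubblingTwoPairChainSplitA

/-!
# Wall bubbling for `DoorA26` — TWO WEYL PAIRS: slot splitting for the doubleton and single values (part of the two-pair chain)

HONEST FRAMING.  Bookkeeping for obligation (W) `stub_weylFaces` (crux `DoorA26`, stmt-ValiantsHypothesis-19979; OPEN, typed, never asserted), W1 seat
val-sym-door-p2 g13 (#52d), a slice of the two-pair chain W1 #52 `…TwoPairChain`: given the doubleton rungs in cluster currency (W1 #51), the `hsplit`
inequality for every value OTHER than `2δ₀`, `2δ₁`, `δ₀+δ₁` — doubletons `δ₀+δ_k`, `δ₁+δ_k` (≤ 1; ≤ 2 for the merged pair on the wall (c2)) and the singles'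
values (0) — read through the member dictionary W1 #52b.  Def-free; nothing on `DoorA26`, 18050 or VP ≠ VNP.  `--supports stmt-ValiantsHypothesis-19979 --as helper`.
-/

-- `Summit.ValiantsHypothesis.ValiantsHypothesis.…` repeats a component by the D-0017 layout
-- (single-conjunct summit), which the `dupNamespace` linter flags; the name is mandated.
set_option linter.dupNamespace false

namespace Summit.ValiantsHypothesis.ValiantsHypothesis.Theorems.LacunarySymmetroidMatrixDescartes.WallBubbling

open Finset
open Bubbling (polar)
open scoped BigOperators

/-- `Σ f ≤ 2` for a `{0,1}`-valued `f` whose support is covered by two families each alive at most once. [folklore] -/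
theorem sum_le_two_of_two_pairwise {C : ℕ} (f : Fin C → ℕ) (A B : Fin C → Prop) (h1 : ∀ c, f c ≤ 1)
    (hAB : ∀ c, f c = 1 → A c ∨ B c)
    (hA : ∀ c c', c < c' → A c → A c' → False) (hB : ∀ c c', c < c' → B c → B c' → False) : ∑ c, f c ≤ 2 := by
  classical
  have hf : ∀ c, f c = (if f c = 1 ∧ A c then 1 else 0) + (if f c = 1 ∧ ¬ A c then 1 else 0) := by
    intro c; have := h1 c
    by_cases hc : f c = 1
    · by_cases hA' : A c
      · rw [if_pos ⟨hc, hA'⟩, if_neg (fun h => h.2 hA')]; omega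
      · rw [if_neg (fun h => hA' h.2), if_pos ⟨hc, hA'⟩]; omega
    · rw [if_neg (fun h => hc h.1), if_neg (fun h => hc h.1)]; omega
  rw [Finset.sum_congr rfl (fun c _ => hf c), Finset.sum_add_distrib, Finset.sum_boole, Finset.sum_boole, Nat.cast_id, Nat.cast_id]
  have hcA : (univ.filter (fun c => f c = 1 ∧ A c)).card ≤ 1 := by
    refine Finset.card_le_one.mpr fun a ha b hb => ?_
    rw [Finset.mem_filter] at ha hb
    by_contra hab
    rcases lt_or_gt_of_ne hab with h | h
    · exact hA a b h ha.2.2 hb.2.2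
    · exact hA b a h hb.2.2 ha.2.2
  have hcB : (univ.filter (fun c => f c = 1 ∧ ¬ A c)).card ≤ 1 := by
    refine Finset.card_le_one.mpr fun a ha b hb => ?_
    rw [Finset.mem_filter] at ha hb
    have hBa : B a := (hAB a ha.2.1).resolve_left ha.2.2
    have hBb : B b := (hAB b hb.2.1).resolve_left hb.2.2
    by_contra hab
    rcases lt_or_gt_of_ne hab with h | h
    · exact hB a b h hBa hBb
    · exact hB b a h hBb hBa
  omega


/-- **Slot splitting for the doubleton and single values at a two-Weyl-pair point.** [this work] -/
theorem twoPair_hsplit_rest (δ0 : Fin 6 → ℝ) (h50 : δ0 5 = δ0 0) (h41 : δ0 4 = δ0 1)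
    (hG : ∀ a b c e : Fin 4, δ0 a.castSucc.castSucc + δ0 b.castSucc.castSucc = δ0 c.castSucc.castSucc + δ0 e.castSucc.castSucc →
      (a = c ∧ b = e) ∨ (a = e ∧ b = c) ∨
        ((((a = 0 ∧ b = 1) ∨ (a = 1 ∧ b = 0)) ∧ ((c = 2 ∧ e = 3) ∨ (c = 3 ∧ e = 2))) ∨
         (((a = 2 ∧ b = 3) ∨ (a = 3 ∧ b = 2)) ∧ ((c = 0 ∧ e = 1) ∨ (c = 1 ∧ e = 0)))) ∨
        ((((a = 0 ∧ b = 2) ∨ (a = 2 ∧ b = 0)) ∧ ((c = 1 ∧ e = 3) ∨ (c = 3 ∧ e = 1))) ∨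
         (((a = 1 ∧ b = 3) ∨ (a = 3 ∧ b = 1)) ∧ ((c = 0 ∧ e = 2) ∨ (c = 2 ∧ e = 0)))))
    {C : ℕ} (Γ : Fin C → Fin 6 → Fin 6 → ℝ) (W : Fin C → Fin 6 → Matrix (Fin 2) (Fin 2) ℝ)
    (hal : ∀ c p q, polar (W c p) (W c q) ≠ 0 ↔ Γ c p q ≠ 0) (hΓsymm : ∀ c a b, Γ c a b = Γ c b a)
    (Rdbl05 : ∀ c c' : Fin C, c < c' → ∀ k : Fin 6, k ≠ 0 → k ≠ 1 → k ≠ 4 → k ≠ 5 → Γ c 5 k ≠ 0 → Γ c' 5 k ≠ 0 → False)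
    (Rdbl14 : ∀ c c' : Fin C, c < c' → ∀ k : Fin 6, k ≠ 0 → k ≠ 1 → k ≠ 4 → k ≠ 5 → Γ c 4 k ≠ 0 → Γ c' 4 k ≠ 0 → False) :
    ∀ w : ℝ, ¬ (w = δ0 0 + δ0 0 ∨ w = δ0 1 + δ0 1 ∨ w = δ0 0 + δ0 1) →
      (∑ c : Fin C, (if w ∈ ((univ : Finset (Fin 6 × Fin 6)).image (fun pq => δ0 pq.1 + δ0 pq.2)).filter (fun w => (∃ p q : Fin 6, δ0 p + δ0 q = w ∧ polar (W c p) (W c q) ≠ 0))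
        then (if (∃ p q : Fin 6, δ0 p + δ0 q = w ∧ polar (W c p) (W c q) ≠ 0 ∧ (if p = 5 then 1 else if p = 4 then 1 else 0) + (if q = 5 then 1 else if q = 4 then 1 else 0) = 2) then 2
          else if (∃ p q : Fin 6, δ0 p + δ0 q = w ∧ polar (W c p) (W c q) ≠ 0 ∧ (if p = 5 then 1 else if p = 4 then 1 else 0) + (if q = 5 then 1 else if q = 4 then 1 else 0) = 1) then 1 else 0) else 0)) ≤ (if ((w = δ0 0 + δ0 2 ∨ w = δ0 0 + δ0 3) ∧ (w = δ0 1 + δ0 2 ∨ w = δ0 1 + δ0 3)) then 3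
        else if (w = δ0 0 + δ0 2 ∨ w = δ0 0 + δ0 3 ∨ w = δ0 1 + δ0 2 ∨ w = δ0 1 + δ0 3) then 2 else 1) - 1 := by
  classical
  set V : Finset ℝ := ((univ : Finset (Fin 6 × Fin 6)).image (fun pq => δ0 pq.1 + δ0 pq.2)) with hV
  -- reading the summand: `= 2` / `= 1` give the corresponding existential
  have hS2 : ∀ (c : Fin C) (w : ℝ), (if w ∈ V.filter (fun w => (∃ p q : Fin 6, δ0 p + δ0 q = w ∧ polar (W c p) (W c q) ≠ 0))
        then (if (∃ p q : Fin 6, δ0 p + δ0 q = w ∧ polar (W c p) (W c q) ≠ 0 ∧ (if p = 5 then 1 else if p = 4 then 1 else 0) + (if q = 5 then 1 else if q = 4 then 1 else 0) = 2) then 2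
          else if (∃ p q : Fin 6, δ0 p + δ0 q = w ∧ polar (W c p) (W c q) ≠ 0 ∧ (if p = 5 then 1 else if p = 4 then 1 else 0) + (if q = 5 then 1 else if q = 4 then 1 else 0) = 1) then 1 else 0) else 0) = 2 →
      ∃ p q : Fin 6, δ0 p + δ0 q = w ∧ polar (W c p) (W c q) ≠ 0 ∧ (if p = 5 then 1 else if p = 4 then 1 else 0) + (if q = 5 then 1 else if q = 4 then 1 else 0) = 2 := by
    intro c w h
    by_contra hn
    by_cases hmem : w ∈ V.filter (fun w => (∃ p q : Fin 6, δ0 p + δ0 q = w ∧ polar (W c p) (W c q) ≠ 0))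
    · rw [if_pos hmem, if_neg hn] at h; split_ifs at h; all_goals omega
    · rw [if_neg hmem] at h; omega
  have hS1' : ∀ (c : Fin C) (w : ℝ), (if w ∈ V.filter (fun w => (∃ p q : Fin 6, δ0 p + δ0 q = w ∧ polar (W c p) (W c q) ≠ 0))
        then (if (∃ p q : Fin 6, δ0 p + δ0 q = w ∧ polar (W c p) (W c q) ≠ 0 ∧ (if p = 5 then 1 else if p = 4 then 1 else 0) + (if q = 5 then 1 else if q = 4 then 1 else 0) = 2) then 2
          else if (∃ p q : Fin 6, δ0 p + δ0 q = w ∧ polar (W c p) (W c q) ≠ 0 ∧ (if p = 5 then 1 else if p = 4 then 1 else 0) + (if q = 5 then 1 else if q = 4 then 1 else 0) = 1) then 1 else 0) else 0) = 1 →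
      ∃ p q : Fin 6, δ0 p + δ0 q = w ∧ polar (W c p) (W c q) ≠ 0 ∧ (if p = 5 then 1 else if p = 4 then 1 else 0) + (if q = 5 then 1 else if q = 4 then 1 else 0) = 1 := by
    intro c w h
    by_contra hn
    by_cases hmem : w ∈ V.filter (fun w => (∃ p q : Fin 6, δ0 p + δ0 q = w ∧ polar (W c p) (W c q) ≠ 0))
    · rw [if_pos hmem] at h
      by_cases h2 : ∃ p q : Fin 6, δ0 p + δ0 q = w ∧ polar (W c p) (W c q) ≠ 0 ∧ (if p = 5 then 1 else if p = 4 then 1 else 0) + (if q = 5 then 1 else if q = 4 then 1 else 0) = 2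
      · rw [if_pos h2] at h; omega
      · rw [if_neg h2, if_neg hn] at h; omega
    · rw [if_neg hmem] at h; omega
  have hSle2 : ∀ (c : Fin C) (w : ℝ), (if w ∈ V.filter (fun w => (∃ p q : Fin 6, δ0 p + δ0 q = w ∧ polar (W c p) (W c q) ≠ 0))
        then (if (∃ p q : Fin 6, δ0 p + δ0 q = w ∧ polar (W c p) (W c q) ≠ 0 ∧ (if p = 5 then 1 else if p = 4 then 1 else 0) + (if q = 5 then 1 else if q = 4 then 1 else 0) = 2) then 2
          else if (∃ p q : Fin 6, δ0 p + δ0 q = w ∧ polar (W c p) (W c q) ≠ 0 ∧ (if p = 5 then 1 else if p = 4 then 1 else 0) + (if q = 5 then 1 else if q = 4 then 1 else 0) = 1) then 1 else 0) else 0) ≤ 2 := by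
    intro c w; split_ifs <;> omega
  have hS0 : ∀ (c : Fin C) (w : ℝ),
      (¬ ∃ p q : Fin 6, δ0 p + δ0 q = w ∧ polar (W c p) (W c q) ≠ 0 ∧ (if p = 5 then 1 else if p = 4 then 1 else 0) + (if q = 5 then 1 else if q = 4 then 1 else 0) = 2) →
      (¬ ∃ p q : Fin 6, δ0 p + δ0 q = w ∧ polar (W c p) (W c q) ≠ 0 ∧ (if p = 5 then 1 else if p = 4 then 1 else 0) + (if q = 5 then 1 else if q = 4 then 1 else 0) = 1) →
      (if w ∈ V.filter (fun w => (∃ p q : Fin 6, δ0 p + δ0 q = w ∧ polar (W c p) (W c q) ≠ 0))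
        then (if (∃ p q : Fin 6, δ0 p + δ0 q = w ∧ polar (W c p) (W c q) ≠ 0 ∧ (if p = 5 then 1 else if p = 4 then 1 else 0) + (if q = 5 then 1 else if q = 4 then 1 else 0) = 2) then 2
          else if (∃ p q : Fin 6, δ0 p + δ0 q = w ∧ polar (W c p) (W c q) ≠ 0 ∧ (if p = 5 then 1 else if p = 4 then 1 else 0) + (if q = 5 then 1 else if q = 4 then 1 else 0) = 1) then 1 else 0) else 0) = 0 := by
    intro c w h2 h1
    rw [if_neg h2, if_neg h1, ite_self]
  -- the member dictionary (W1 #52b), instantiated at cluster `c`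
  have hAs : ∀ (c : Fin C) (p q : Fin 6), Γ c p q ≠ 0 → Γ c q p ≠ 0 := fun c p q h => by rwa [hΓsymm]
  have dD02_2 : ∀ (c : Fin C) (p q : Fin 6), δ0 p + δ0 q = δ0 0 + δ0 2 → polar (W c p) (W c q) ≠ 0 →
      (if p = 5 then 1 else if p = 4 then 1 else 0) + (if q = 5 then 1 else if q = 4 then 1 else 0) = 2 → False :=
    fun c p q h1 h2 h3 => twoPair_dict_D02_2 δ0 h50 h41 hG (fun p q => Γ c p q ≠ 0) (hAs c) p q h1 ((hal c p q).mp h2) h3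
  have dD02_1 : ∀ (c : Fin C) (p q : Fin 6), δ0 p + δ0 q = δ0 0 + δ0 2 → polar (W c p) (W c q) ≠ 0 →
      (if p = 5 then 1 else if p = 4 then 1 else 0) + (if q = 5 then 1 else if q = 4 then 1 else 0) = 1 → Γ c 5 2 ≠ 0 ∨ (Γ c 4 3 ≠ 0 ∧ δ0 1 + δ0 3 = δ0 0 + δ0 2) :=
    fun c p q h1 h2 h3 => twoPair_dict_D02_1 δ0 h50 h41 hG (fun p q => Γ c p q ≠ 0) (hAs c) p q h1 ((hal c p q).mp h2) h3
  have dD03_2 : ∀ (c : Fin C) (p q : Fin 6), δ0 p + δ0 q = δ0 0 + δ0 3 → polar (W c p) (W c q) ≠ 0 →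
      (if p = 5 then 1 else if p = 4 then 1 else 0) + (if q = 5 then 1 else if q = 4 then 1 else 0) = 2 → False :=
    fun c p q h1 h2 h3 => twoPair_dict_D03_2 δ0 h50 h41 hG (fun p q => Γ c p q ≠ 0) (hAs c) p q h1 ((hal c p q).mp h2) h3
  have dD03_1 : ∀ (c : Fin C) (p q : Fin 6), δ0 p + δ0 q = δ0 0 + δ0 3 → polar (W c p) (W c q) ≠ 0 →
      (if p = 5 then 1 else if p = 4 then 1 else 0) + (if q = 5 then 1 else if q = 4 then 1 else 0) = 1 → Γ c 5 3 ≠ 0 :=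
    fun c p q h1 h2 h3 => twoPair_dict_D03_1 δ0 h50 h41 hG (fun p q => Γ c p q ≠ 0) (hAs c) p q h1 ((hal c p q).mp h2) h3
  have dD12_2 : ∀ (c : Fin C) (p q : Fin 6), δ0 p + δ0 q = δ0 1 + δ0 2 → polar (W c p) (W c q) ≠ 0 →
      (if p = 5 then 1 else if p = 4 then 1 else 0) + (if q = 5 then 1 else if q = 4 then 1 else 0) = 2 → False :=
    fun c p q h1 h2 h3 => twoPair_dict_D12_2 δ0 h50 h41 hG (fun p q => Γ c p q ≠ 0) (hAs c) p q h1 ((hal c p q).mp h2) h3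
  have dD12_1 : ∀ (c : Fin C) (p q : Fin 6), δ0 p + δ0 q = δ0 1 + δ0 2 → polar (W c p) (W c q) ≠ 0 →
      (if p = 5 then 1 else if p = 4 then 1 else 0) + (if q = 5 then 1 else if q = 4 then 1 else 0) = 1 → Γ c 4 2 ≠ 0 :=
    fun c p q h1 h2 h3 => twoPair_dict_D12_1 δ0 h50 h41 hG (fun p q => Γ c p q ≠ 0) (hAs c) p q h1 ((hal c p q).mp h2) h3
  have dD13_2 : ∀ (c : Fin C) (p q : Fin 6), δ0 p + δ0 q = δ0 1 + δ0 3 → polar (W c p) (W c q) ≠ 0 →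
      (if p = 5 then 1 else if p = 4 then 1 else 0) + (if q = 5 then 1 else if q = 4 then 1 else 0) = 2 → False :=
    fun c p q h1 h2 h3 => twoPair_dict_D13_2 δ0 h50 h41 hG (fun p q => Γ c p q ≠ 0) (hAs c) p q h1 ((hal c p q).mp h2) h3
  have dD13_1 : ∀ (c : Fin C) (p q : Fin 6), δ0 p + δ0 q = δ0 1 + δ0 3 → polar (W c p) (W c q) ≠ 0 →
      (if p = 5 then 1 else if p = 4 then 1 else 0) + (if q = 5 then 1 else if q = 4 then 1 else 0) = 1 → Γ c 4 3 ≠ 0 ∨ (Γ c 5 2 ≠ 0 ∧ δ0 0 + δ0 2 = δ0 1 + δ0 3) :=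
    fun c p q h1 h2 h3 => twoPair_dict_D13_1 δ0 h50 h41 hG (fun p q => Γ c p q ≠ 0) (hAs c) p q h1 ((hal c p q).mp h2) h3

  have hn_02_12 : δ0 0 + δ0 2 ≠ δ0 1 + δ0 2 := by
    intro h; rcases hG 0 2 1 2 h with ⟨h1, h2⟩ | ⟨h1, h2⟩ | ⟨⟨h1, h2⟩ | ⟨h1, h2⟩⟩ | ⟨⟨h1, h2⟩ | ⟨h1, h2⟩⟩
    · exact absurd h1 (by decide)
    · exact absurd h1 (by decide)
    · exact absurd h1 (by decide)
    · exact absurd h1 (by decide)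
    · exact absurd h2 (by decide)
    · exact absurd h1 (by decide)
  have hn_03_12 : δ0 0 + δ0 3 ≠ δ0 1 + δ0 2 := by
    intro h; rcases hG 0 3 1 2 h with ⟨h1, h2⟩ | ⟨h1, h2⟩ | ⟨⟨h1, h2⟩ | ⟨h1, h2⟩⟩ | ⟨⟨h1, h2⟩ | ⟨h1, h2⟩⟩
    · exact absurd h1 (by decide)
    · exact absurd h1 (by decide)
    · exact absurd h1 (by decide)
    · exact absurd h1 (by decide)
    · exact absurd h1 (by decide)
    · exact absurd h1 (by decide)
  have hn_03_13 : δ0 0 + δ0 3 ≠ δ0 1 + δ0 3 := by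
    intro h; rcases hG 0 3 1 3 h with ⟨h1, h2⟩ | ⟨h1, h2⟩ | ⟨⟨h1, h2⟩ | ⟨h1, h2⟩⟩ | ⟨⟨h1, h2⟩ | ⟨h1, h2⟩⟩
    · exact absurd h1 (by decide)
    · exact absurd h1 (by decide)
    · exact absurd h1 (by decide)
    · exact absurd h1 (by decide)
    · exact absurd h1 (by decide)
    · exact absurd h1 (by decide)
  have hn_12_02 : δ0 1 + δ0 2 ≠ δ0 0 + δ0 2 := by
    intro h; rcases hG 1 2 0 2 h with ⟨h1, h2⟩ | ⟨h1, h2⟩ | ⟨⟨h1, h2⟩ | ⟨h1, h2⟩⟩ | ⟨⟨h1, h2⟩ | ⟨h1, h2⟩⟩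
    · exact absurd h1 (by decide)
    · exact absurd h1 (by decide)
    · exact absurd h1 (by decide)
    · exact absurd h1 (by decide)
    · exact absurd h1 (by decide)
    · exact absurd h1 (by decide)
  have hn_12_03 : δ0 1 + δ0 2 ≠ δ0 0 + δ0 3 := by
    intro h; rcases hG 1 2 0 3 h with ⟨h1, h2⟩ | ⟨h1, h2⟩ | ⟨⟨h1, h2⟩ | ⟨h1, h2⟩⟩ | ⟨⟨h1, h2⟩ | ⟨h1, h2⟩⟩
    · exact absurd h1 (by decide)
    · exact absurd h1 (by decide)
    · exact absurd h1 (by decide)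
    · exact absurd h1 (by decide)
    · exact absurd h1 (by decide)
    · exact absurd h1 (by decide)
  have hn_13_03 : δ0 1 + δ0 3 ≠ δ0 0 + δ0 3 := by
    intro h; rcases hG 1 3 0 3 h with ⟨h1, h2⟩ | ⟨h1, h2⟩ | ⟨⟨h1, h2⟩ | ⟨h1, h2⟩⟩ | ⟨⟨h1, h2⟩ | ⟨h1, h2⟩⟩
    · exact absurd h1 (by decide)
    · exact absurd h1 (by decide)
    · exact absurd h1 (by decide)
    · exact absurd h1 (by decide)
    · exact absurd h1 (by decide)
    · exact absurd h2 (by decide)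
  intro w hn1
  have hT0 : ¬ w = δ0 0 + δ0 0 := fun h => hn1 (Or.inl h)
  have hT1 : ¬ w = δ0 1 + δ0 1 := fun h => hn1 (Or.inr (Or.inl h))
  have hMx : ¬ w = δ0 0 + δ0 1 := fun h => hn1 (Or.inr (Or.inr h))
  by_cases hD02 : w = δ0 0 + δ0 2
  · subst hD02
    have hS1le : ∀ c : Fin C, (if (δ0 0 + δ0 2) ∈ V.filter (fun w => (∃ p q : Fin 6, δ0 p + δ0 q = w ∧ polar (W c p) (W c q) ≠ 0))
      then (if (∃ p q : Fin 6, δ0 p + δ0 q = (δ0 0 + δ0 2) ∧ polar (W c p) (W c q) ≠ 0 ∧ (if p = 5 then 1 else if p = 4 then 1 else 0) + (if q = 5 then 1 else if q = 4 then 1 else 0) = 2) then 2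
        else if (∃ p q : Fin 6, δ0 p + δ0 q = (δ0 0 + δ0 2) ∧ polar (W c p) (W c q) ≠ 0 ∧ (if p = 5 then 1 else if p = 4 then 1 else 0) + (if q = 5 then 1 else if q = 4 then 1 else 0) = 1) then 1 else 0) else 0) ≤ 1 := by
      intro c
      have h2 : ¬ ∃ p q : Fin 6, δ0 p + δ0 q = (δ0 0 + δ0 2) ∧ polar (W c p) (W c q) ≠ 0 ∧ (if p = 5 then 1 else if p = 4 then 1 else 0) + (if q = 5 then 1 else if q = 4 then 1 else 0) = 2 :=
        fun ⟨p, q, a1, a2, a3⟩ => dD02_2 c p q a1 a2 a3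
      by_cases hmem : (δ0 0 + δ0 2) ∈ V.filter (fun w => (∃ p q : Fin 6, δ0 p + δ0 q = w ∧ polar (W c p) (W c q) ≠ 0))
      · rw [if_pos hmem, if_neg h2]; split_ifs <;> omega
      · rw [if_neg hmem]; omega
    by_cases hmg : δ0 1 + δ0 3 = δ0 0 + δ0 2
    · -- merged with δ₁+δ₃ (wall (c2)): two exclusive families
      rw [if_pos ⟨Or.inl rfl, Or.inr hmg.symm⟩]
      refine (sum_le_two_of_two_pairwise _ (fun c => Γ c 5 2 ≠ 0) (fun c => Γ c 4 3 ≠ 0) hS1le ?_ ?_ ?_).trans (by norm_num)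
      · intro c hfc
        obtain ⟨p, q, hpq, hpol, hdg⟩ := hS1' c _ hfc
        exact (dD02_1 c p q hpq hpol hdg).imp id And.left
      · intro c c' hcc' h1 h2; exact Rdbl05 c c' hcc' 2 (by decide) (by decide) (by decide) (by decide) h1 h2
      · intro c c' hcc' h1 h2; exact Rdbl14 c c' hcc' 3 (by decide) (by decide) (by decide) (by decide) h1 h2
    · have hn2 : ¬ (((δ0 0 + δ0 2) = δ0 0 + δ0 2 ∨ (δ0 0 + δ0 2) = δ0 0 + δ0 3) ∧ ((δ0 0 + δ0 2) = δ0 1 + δ0 2 ∨ (δ0 0 + δ0 2) = δ0 1 + δ0 3)) := by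
        rintro ⟨-, h | h⟩
        · exact hn_02_12 h
        · exact hmg h.symm
      rw [if_neg hn2, if_pos (Or.inl rfl)]
      refine (sum_le_one_of_pairwise _ hS1le ?_).trans (by norm_num)
      intro c c' hcc' h1 h2
      obtain ⟨p, q, hpq, hpol, hdg⟩ := hS1' c _ h1
      obtain ⟨p', q', hpq', hpol', hdg'⟩ := hS1' c' _ h2
      have g1 : Γ c 5 2 ≠ 0 := (dD02_1 c p q hpq hpol hdg).elim id (fun h => absurd h.2 hmg)
      have g2 : Γ c' 5 2 ≠ 0 := (dD02_1 c' p' q' hpq' hpol' hdg').elim id (fun h => absurd h.2 hmg)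
      exact Rdbl05 c c' hcc' 2 (by decide) (by decide) (by decide) (by decide) g1 g2
  by_cases hD03 : w = δ0 0 + δ0 3
  · subst hD03
    have hS1le : ∀ c : Fin C, (if (δ0 0 + δ0 3) ∈ V.filter (fun w => (∃ p q : Fin 6, δ0 p + δ0 q = w ∧ polar (W c p) (W c q) ≠ 0))
      then (if (∃ p q : Fin 6, δ0 p + δ0 q = (δ0 0 + δ0 3) ∧ polar (W c p) (W c q) ≠ 0 ∧ (if p = 5 then 1 else if p = 4 then 1 else 0) + (if q = 5 then 1 else if q = 4 then 1 else 0) = 2) then 2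
        else if (∃ p q : Fin 6, δ0 p + δ0 q = (δ0 0 + δ0 3) ∧ polar (W c p) (W c q) ≠ 0 ∧ (if p = 5 then 1 else if p = 4 then 1 else 0) + (if q = 5 then 1 else if q = 4 then 1 else 0) = 1) then 1 else 0) else 0) ≤ 1 := by
      intro c
      have h2 : ¬ ∃ p q : Fin 6, δ0 p + δ0 q = (δ0 0 + δ0 3) ∧ polar (W c p) (W c q) ≠ 0 ∧ (if p = 5 then 1 else if p = 4 then 1 else 0) + (if q = 5 then 1 else if q = 4 then 1 else 0) = 2 :=
        fun ⟨p, q, a1, a2, a3⟩ => dD03_2 c p q a1 a2 a3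
      by_cases hmem : (δ0 0 + δ0 3) ∈ V.filter (fun w => (∃ p q : Fin 6, δ0 p + δ0 q = w ∧ polar (W c p) (W c q) ≠ 0))
      · rw [if_pos hmem, if_neg h2]; split_ifs <;> omega
      · rw [if_neg hmem]; omega
    have hn2 : ¬ (((δ0 0 + δ0 3) = δ0 0 + δ0 2 ∨ (δ0 0 + δ0 3) = δ0 0 + δ0 3) ∧ ((δ0 0 + δ0 3) = δ0 1 + δ0 2 ∨ (δ0 0 + δ0 3) = δ0 1 + δ0 3)) := by
      rintro ⟨-, h | h⟩
      · exact hn_03_12 h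
      · exact hn_03_13 h
    rw [if_neg hn2, if_pos (Or.inr (Or.inl rfl))]
    refine (sum_le_one_of_pairwise _ hS1le ?_).trans (by norm_num)
    intro c c' hcc' h1 h2
    obtain ⟨p, q, hpq, hpol, hdg⟩ := hS1' c _ h1
    obtain ⟨p', q', hpq', hpol', hdg'⟩ := hS1' c' _ h2
    exact Rdbl05 c c' hcc' 3 (by decide) (by decide) (by decide) (by decide) (dD03_1 c p q hpq hpol hdg) (dD03_1 c' p' q' hpq' hpol' hdg')
  by_cases hD12 : w = δ0 1 + δ0 2
  · subst hD12
    have hS1le : ∀ c : Fin C, (if (δ0 1 + δ0 2) ∈ V.filter (fun w => (∃ p q : Fin 6, δ0 p + δ0 q = w ∧ polar (W c p) (W c q) ≠ 0))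
      then (if (∃ p q : Fin 6, δ0 p + δ0 q = (δ0 1 + δ0 2) ∧ polar (W c p) (W c q) ≠ 0 ∧ (if p = 5 then 1 else if p = 4 then 1 else 0) + (if q = 5 then 1 else if q = 4 then 1 else 0) = 2) then 2
        else if (∃ p q : Fin 6, δ0 p + δ0 q = (δ0 1 + δ0 2) ∧ polar (W c p) (W c q) ≠ 0 ∧ (if p = 5 then 1 else if p = 4 then 1 else 0) + (if q = 5 then 1 else if q = 4 then 1 else 0) = 1) then 1 else 0) else 0) ≤ 1 := by
      intro c
      have h2 : ¬ ∃ p q : Fin 6, δ0 p + δ0 q = (δ0 1 + δ0 2) ∧ polar (W c p) (W c q) ≠ 0 ∧ (if p = 5 then 1 else if p = 4 then 1 else 0) + (if q = 5 then 1 else if q = 4 then 1 else 0) = 2 :=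
        fun ⟨p, q, a1, a2, a3⟩ => dD12_2 c p q a1 a2 a3
      by_cases hmem : (δ0 1 + δ0 2) ∈ V.filter (fun w => (∃ p q : Fin 6, δ0 p + δ0 q = w ∧ polar (W c p) (W c q) ≠ 0))
      · rw [if_pos hmem, if_neg h2]; split_ifs <;> omega
      · rw [if_neg hmem]; omega
    have hn2 : ¬ (((δ0 1 + δ0 2) = δ0 0 + δ0 2 ∨ (δ0 1 + δ0 2) = δ0 0 + δ0 3) ∧ ((δ0 1 + δ0 2) = δ0 1 + δ0 2 ∨ (δ0 1 + δ0 2) = δ0 1 + δ0 3)) := by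
      rintro ⟨h | h, -⟩
      · exact hn_12_02 h
      · exact hn_12_03 h
    rw [if_neg hn2, if_pos (Or.inr (Or.inr (Or.inl rfl)))]
    refine (sum_le_one_of_pairwise _ hS1le ?_).trans (by norm_num)
    intro c c' hcc' h1 h2
    obtain ⟨p, q, hpq, hpol, hdg⟩ := hS1' c _ h1
    obtain ⟨p', q', hpq', hpol', hdg'⟩ := hS1' c' _ h2
    exact Rdbl14 c c' hcc' 2 (by decide) (by decide) (by decide) (by decide) (dD12_1 c p q hpq hpol hdg) (dD12_1 c' p' q' hpq' hpol' hdg')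
  by_cases hD13 : w = δ0 1 + δ0 3
  · subst hD13
    have hS1le : ∀ c : Fin C, (if (δ0 1 + δ0 3) ∈ V.filter (fun w => (∃ p q : Fin 6, δ0 p + δ0 q = w ∧ polar (W c p) (W c q) ≠ 0))
      then (if (∃ p q : Fin 6, δ0 p + δ0 q = (δ0 1 + δ0 3) ∧ polar (W c p) (W c q) ≠ 0 ∧ (if p = 5 then 1 else if p = 4 then 1 else 0) + (if q = 5 then 1 else if q = 4 then 1 else 0) = 2) then 2
        else if (∃ p q : Fin 6, δ0 p + δ0 q = (δ0 1 + δ0 3) ∧ polar (W c p) (W c q) ≠ 0 ∧ (if p = 5 then 1 else if p = 4 then 1 else 0) + (if q = 5 then 1 else if q = 4 then 1 else 0) = 1) then 1 else 0) else 0) ≤ 1 := by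
      intro c
      have h2 : ¬ ∃ p q : Fin 6, δ0 p + δ0 q = (δ0 1 + δ0 3) ∧ polar (W c p) (W c q) ≠ 0 ∧ (if p = 5 then 1 else if p = 4 then 1 else 0) + (if q = 5 then 1 else if q = 4 then 1 else 0) = 2 :=
        fun ⟨p, q, a1, a2, a3⟩ => dD13_2 c p q a1 a2 a3
      by_cases hmem : (δ0 1 + δ0 3) ∈ V.filter (fun w => (∃ p q : Fin 6, δ0 p + δ0 q = w ∧ polar (W c p) (W c q) ≠ 0))
      · rw [if_pos hmem, if_neg h2]; split_ifs <;> omega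
      · rw [if_neg hmem]; omega
    have hn2 : ¬ (((δ0 1 + δ0 3) = δ0 0 + δ0 2 ∨ (δ0 1 + δ0 3) = δ0 0 + δ0 3) ∧ ((δ0 1 + δ0 3) = δ0 1 + δ0 2 ∨ (δ0 1 + δ0 3) = δ0 1 + δ0 3)) := by
      rintro ⟨h | h, -⟩
      · exact hD02 h
      · exact hn_13_03 h
    rw [if_neg hn2, if_pos (Or.inr (Or.inr (Or.inr rfl)))]
    refine (sum_le_one_of_pairwise _ hS1le ?_).trans (by norm_num)
    intro c c' hcc' h1 h2
    obtain ⟨p, q, hpq, hpol, hdg⟩ := hS1' c _ h1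
    obtain ⟨p', q', hpq', hpol', hdg'⟩ := hS1' c' _ h2
    have g1 : Γ c 4 3 ≠ 0 := (dD13_1 c p q hpq hpol hdg).elim id (fun h => absurd h.2.symm hD02)
    have g2 : Γ c' 4 3 ≠ 0 := (dD13_1 c' p' q' hpq' hpol' hdg').elim id (fun h => absurd h.2.symm hD02)
    exact Rdbl14 c c' hcc' 3 (by decide) (by decide) (by decide) (by decide) g1 g2
  -- a singles' value: every alive member has degree 0
  have hn3 : ¬ (w = δ0 0 + δ0 2 ∨ w = δ0 0 + δ0 3 ∨ w = δ0 1 + δ0 2 ∨ w = δ0 1 + δ0 3) := by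
    rintro (h | h | h | h)
    · exact hD02 h
    · exact hD03 h
    · exact hD12 h
    · exact hD13 h
  have hn2 : ¬ ((w = δ0 0 + δ0 2 ∨ w = δ0 0 + δ0 3) ∧ (w = δ0 1 + δ0 2 ∨ w = δ0 1 + δ0 3)) := fun h => hn3 (h.1.elim Or.inl (fun h' => Or.inr (Or.inl h')))
  rw [if_neg hn2, if_neg hn3]
  have hdeg0 := twoPair_dict_S δ0 h50 h41 w hT0 hT1 hMx hD02 hD03 hD12 hD13
  have hzero : ∀ c : Fin C, (if w ∈ V.filter (fun w => (∃ p q : Fin 6, δ0 p + δ0 q = w ∧ polar (W c p) (W c q) ≠ 0))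
      then (if (∃ p q : Fin 6, δ0 p + δ0 q = w ∧ polar (W c p) (W c q) ≠ 0 ∧ (if p = 5 then 1 else if p = 4 then 1 else 0) + (if q = 5 then 1 else if q = 4 then 1 else 0) = 2) then 2
        else if (∃ p q : Fin 6, δ0 p + δ0 q = w ∧ polar (W c p) (W c q) ≠ 0 ∧ (if p = 5 then 1 else if p = 4 then 1 else 0) + (if q = 5 then 1 else if q = 4 then 1 else 0) = 1) then 1 else 0) else 0) = 0 := by
    intro c
    refine hS0 c w ?_ ?_
    · rintro ⟨p, q, hpq, -, hdg⟩; exact hdeg0 p q 2 hpq hdg (Or.inr rfl)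
    · rintro ⟨p, q, hpq, -, hdg⟩; exact hdeg0 p q 1 hpq hdg (Or.inl rfl)
  rw [Finset.sum_eq_zero (fun c _ => hzero c)]
  exact Nat.zero_le _

end Summit.ValiantsHypothesis.ValiantsHypothesis.Theorems.LacunarySymmetroidMatrixDescartes.WallBubbling
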